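import Literature.AnabelianGeometry.AbsoluteAnabelian.MonoidKummerGaloisCyclotomeJunctionBridge
import Literature.AnabelianGeometry.AbsoluteAnabelian.UnitKummerCyclotomeJunctionFundamentalProofs
import HarnessLib

/-!
# [AbsTopIII] Prop 3.3 (i) clause (c) through THE junction is NATURAL across base fields: presentations that
# differ by (the groupification of) an isomorphism of model `TM`-pairs give corresponding cyclotome classes

S. Mochizuki, *Topics in absolute anabelian geometry III*, §3 (bib key `MochizukiAbsTopIII2015`): Prop. 3.3 (i) p. 73
(«functorial algorithms» for MLF-Galois `TLG`/`TCG`-pairs; clause (c): «the natural isomorphism `μ_Ẑ(M) ⥲ μ_Ẑ(G)` [cf.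
Remark 3.2.1] is only determined up to a `{±1}`- (respectively, `Ẑ^×`-) multiple»), Rmk. 3.2.1 p. 73 («a functorial
algorithm for constructing the natural isomorphism»), Def. 3.1 (iii) p. 68 (groupification `𝒞_TM → 𝒞_TLG`).

abc-iut cell, layer L4, node AbsTopIII:Prop3.3(i), row «P33i-FUND-NATURALITY-TM» (seat abc-iut-w4-d009 gen 5).  PROOF-ONLY.
Inputs BY NAME: abc-iut-L4-t2's isomorphism-of-model-`TM`-pairs machine (`GaloisMonoidPair.Iso.tlgIso`, `absGaloisIso`,
`MLFGaloisTMIsoUnitsTransport.lean` p441441) and junction bridge `cyclotomeUnitsEquivMuZhatFund_map_unitsLift`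
(`MonoidKummerGaloisCyclotomeJunctionBridge.lean` p443804: THE junctions intertwine `Λ(f_M^gp)` with the group-theoretic
`μ_Ẑ(ᾱ)`), THE junction / THE presented theories (`UnitKummerCyclotomeJunctionFundamental(Proofs).lean`, p442940/p443872).

* `GaloisMonoidPair.Iso.coe_tlgIso_isoM_apply` — the object component of `f.tlgIso` on `k̄₁^× = (k̄₁)⁰` IS `unitsLift f_M`
  (Def. 3.1 (iii), read in units);
* `GaloisMonoidPair.Iso.cyclotomeNonZeroDivisorsEquiv_cyclotomeCongr_tlgIso` — on cyclotomes:
  `Λ-units₂ ∘ μ_Ẑ(f.tlgIso_M) = Λ(unitsLift f_M) ∘ Λ-units₁` (`cyclotomeNonZeroDivisorsEquiv : μ_Ẑ(k̄^×) ⥲ Λ(k̄ˣ)`);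
* **`GaloisMonoidPair.TLGPresentation.unitKummerTheoryMuZhatFund_cycIsoClass_of_tmIso`** — for a `TLG` presentation `π`
  of an abstract pair `P` by `(k₂, k̄₂)` and an isomorphism `f : (Π₁ ↷ 𝒪_k̄₁^⊳) ⥲ (Π₂ ↷ 𝒪_k̄₂^⊳)` of model `TM`-pairs, the
  presentation `π ∘ f^gp` of `P` by `(k₁, k̄₁)` gives THE class of `π` after re-targeting along the GROUP-THEORETIC
  `μ_Ẑ(ᾱ) : μ_Ẑ(G_{k₁}) ⥲ μ_Ẑ(G_{k₂})`: `(π∘f^gp).Fund.mapCyclotome μ_Ẑ(ᾱ)` and `π.Fund` have the SAME cyclotome class —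
  presentation-independence of clause (c) ACROSS BASE FIELDS along groupified `TM`-isomorphisms (and, by the twist
  criterion p441869, along their inverse twists); the `TCG` twin `TCGPresentation.…_of_muZhat_congr` holds along ANY
  identification of the targets (the `Ẑ^×`-torsor is everything: `UnitKummerTheory.mem_cycIsoClass_of_TCG`).

HONEST RESIDUAL (named, not claimed): naturality of the `TLG` class along an ARBITRARY isomorphism of model `TLG`-pairs
(not of the form `± f^gp`) is exactly the uniqueness half of Prop. 3.3 (ii) (`Aut_{G_k}(k̄^×) = {±1}`, print p. 74), not
proved here.  ELABORATION NOTE: class equalities are written `@Eq (Set (μ_Ẑ(M) ≃* μ_Ẑ(G_k))) lhs rhs` (type first; see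
`UnitKummerCyclotomeJunctionTLGTwist.lean`) and proved by mutual inclusion through the torsor axioms, never by comparing
the two theories' `muG` slots.  HONEST FRAMING: classical; nothing here bears on [IUTchIII] Cor. 3.12; no side taken.
-/

noncomputable section

open scoped nonZeroDivisors

namespace Literature.AnabelianGeometry.AbsoluteAnabelian

open Field
open Literature.AlgebraicGeometry.Frobenioids (gpMap gpMap_of)

/-! ### `TCG` classes are everything -/

namespace UnitKummerTheory

variable {P : GaloisMonoidPair.{0}}

/-- A `TCG` cyclotome class contains EVERY isomorphism onto its target (non-empty + full `Aut μ_Ẑ(M)`-torsor).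
[cite: MochizukiAbsTopIII2015, Proposition 3.3 (i) p.73] -/
theorem mem_cycIsoClass_of_TCG (U : UnitKummerTheory .TCG P) (e : cyclotome P.M ≃* U.muG) : e ∈ U.cycIsoClass := by
  obtain ⟨e₀, he₀⟩ := U.cycIsoClass_nonempty
  obtain ⟨e₂, he₂, hcomp⟩ := U.cycIsoClass_full e₀ he₀ (e.trans e₀.symm) (fun h => PairType.noConfusion h)
  have heq : e₂ = e := MulEquiv.ext fun ζ => by rw [hcomp, MulEquiv.trans_apply, MulEquiv.apply_symm_apply]
  exact heq ▸ he₂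

end UnitKummerTheory

/-! ### The object component of `f.tlgIso` is `unitsLift f_M`; the cyclotome square -/

namespace GaloisMonoidPair.Iso

variable {C₁ C₂ : MLFClosure.{0}} {D₁ : ModelMLFGaloisData C₁.k C₁.K} {D₂ : ModelMLFGaloisData C₂.k C₂.K}
  (f : GaloisMonoidPair.Iso D₁.tmPair D₂.tmPair)

/-- `f.tlgIso` on an INTEGRAL element `m ∈ 𝒪_k̄₁^⊳ ⊆ k̄₁^×` is `f_M m` (Def. 3.1 (iii): the groupification extends `f_M`).
[cite: MochizukiAbsTopIII2015, Definition 3.1 (iii) p.68] -/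
theorem coe_tlgIso_isoM_coe (m : nonzeroIntegers C₁.k C₁.K) :
    ((f.tlgIso.isoM ⟨(m : C₁.K), mem_nonZeroDivisors_of_ne_zero m.2.2⟩ : D₂.tlgPair.M) : C₂.K) = (f.isoM m : C₂.K) := by
  have h1 : (ModelMLFGaloisData.gpEquivNonZeroDivisors C₁).symm ⟨(m : C₁.K), mem_nonZeroDivisors_of_ne_zero m.2.2⟩ =
      Algebra.GrothendieckGroup.of m :=
    (MulEquiv.symm_apply_eq _).mpr (Subtype.ext (ModelMLFGaloisData.gpToNonZeroDivisors_of m).symm)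
  change ((ModelMLFGaloisData.gpEquivNonZeroDivisors C₂ (gpMapEquiv f.isoM
      ((ModelMLFGaloisData.gpEquivNonZeroDivisors C₁).symm ⟨(m : C₁.K), mem_nonZeroDivisors_of_ne_zero m.2.2⟩)) :
        nonZeroDivisors C₂.K) : C₂.K) = (f.isoM m : C₂.K)
  rw [h1, gpMapEquiv_apply, gpMap_of, ModelMLFGaloisData.gpEquivNonZeroDivisors_apply,
    ModelMLFGaloisData.gpToNonZeroDivisors_of]
  rfl

/-- **The object component of `f.tlgIso` on `k̄₁^× = (k̄₁)⁰` IS `unitsLift f_M`** (both extend `f_M` multiplicatively and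
`𝒪_k̄₁^⊳` generates `k̄₁^×` as a group). [cite: MochizukiAbsTopIII2015, Definition 3.1 (iii) p.68] -/
theorem coe_tlgIso_isoM_apply (x : D₁.tlgPair.M) :
    ((f.tlgIso.isoM x : D₂.tlgPair.M) : C₂.K) =
      ((ModelMLFGaloisData.unitsLift f.isoM.toMonoidHom (nonZeroDivisorsEquivUnits x) : (C₂.K)ˣ) : C₂.K) := by
  -- the composite `k̄₁ˣ ≃ (k̄₁)⁰ ⥲ (k̄₂)⁰ ≃ k̄₂ˣ` extends `f_M`, hence is `unitsLift f_M`
  set F : (C₁.K)ˣ →* (C₂.K)ˣ :=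
    (nonZeroDivisorsEquivUnits : (C₂.K)⁰ ≃* (C₂.K)ˣ).toMonoidHom.comp
      (f.tlgIso.isoM.toMonoidHom.comp (nonZeroDivisorsEquivUnits : (C₁.K)⁰ ≃* (C₁.K)ˣ).symm.toMonoidHom) with hF
  have hFx : ∀ y : D₁.tlgPair.M, F (nonZeroDivisorsEquivUnits y) = nonZeroDivisorsEquivUnits (f.tlgIso.isoM y) := by
    intro y
    change (nonZeroDivisorsEquivUnits : (C₂.K)⁰ ≃* (C₂.K)ˣ) (f.tlgIso.isoM
      ((nonZeroDivisorsEquivUnits : (C₁.K)⁰ ≃* (C₁.K)ˣ).symm (nonZeroDivisorsEquivUnits y))) = _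
    rw [MulEquiv.symm_apply_apply]
  have hFeq : F = ModelMLFGaloisData.unitsLift f.isoM.toMonoidHom := by
    refine ModelMLFGaloisData.unitsLift_unique _ F fun m => ?_
    have hm : ModelMLFGaloisData.toUnit m =
        nonZeroDivisorsEquivUnits (⟨(m : C₁.K), mem_nonZeroDivisors_of_ne_zero m.2.2⟩ : nonZeroDivisors C₁.K) :=
      Units.ext rfl
    rw [hm, hFx]
    exact Units.ext (f.coe_tlgIso_isoM_coe m)
  have key := hFx x
  rw [hFeq] at key
  have key' := congrArg (fun u : (C₂.K)ˣ => (u : C₂.K)) key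
  exact key'.symm

/-- **The cyclotome square of `f.tlgIso`**: `Λ-units₂ (μ_Ẑ(f.tlgIso_M) ξ) = Λ(unitsLift f_M) (Λ-units₁ ξ)` for `ξ ∈ μ_Ẑ(k̄₁^×)`
(`cyclotomeNonZeroDivisorsEquiv : μ_Ẑ(k̄^×) = Λ((k̄^×)ˣ) ⥲ Λ(k̄ˣ)`, `cyclotomeCongr` = functoriality of `μ_Ẑ` in isomorphisms).
[cite: MochizukiAbsTopIII2015, Definition 3.1 (v) p.69] -/
theorem cyclotomeNonZeroDivisorsEquiv_cyclotomeCongr_tlgIso (ξ : cyclotome D₁.tlgPair.M) :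
    C₂.cyclotomeNonZeroDivisorsEquiv (MonoidKummerTheory.cyclotomeCongr f.tlgIso.isoM ξ) =
      EtaleTheta.cyclotome.map (ModelMLFGaloisData.unitsLift f.isoM.toMonoidHom) (C₁.cyclotomeNonZeroDivisorsEquiv ξ) := by
  refine Subtype.ext (funext fun n => Units.ext ?_)
  have hu : nonZeroDivisorsEquivUnits ((((ξ : ℕ+ → (D₁.tlgPair.M)ˣ) n : (D₁.tlgPair.M)ˣ) : D₁.tlgPair.M)) =
      (((C₁.cyclotomeNonZeroDivisorsEquiv ξ : EtaleTheta.cyclotome (C₁.K)ˣ) : ℕ+ → (C₁.K)ˣ) n) :=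
    Units.ext rfl
  change ((f.tlgIso.isoM (((ξ : ℕ+ → (D₁.tlgPair.M)ˣ) n : (D₁.tlgPair.M)ˣ) : D₁.tlgPair.M) : D₂.tlgPair.M) : C₂.K) =
    ((ModelMLFGaloisData.unitsLift f.isoM.toMonoidHom
      (((C₁.cyclotomeNonZeroDivisorsEquiv ξ : EtaleTheta.cyclotome (C₁.K)ˣ) : ℕ+ → (C₁.K)ˣ) n) : (C₂.K)ˣ) : C₂.K)
  rw [coe_tlgIso_isoM_apply, hu]

end GaloisMonoidPair.Iso

/-! ### THE presented classes are natural across base fields along groupified `TM`-isomorphisms -/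

namespace GaloisMonoidPair

namespace TLGPresentation

variable {P : GaloisMonoidPair.{0}} (π : P.TLGPresentation) {C₁ : MLFClosure.{0}} {D₁ : ModelMLFGaloisData C₁.k C₁.K}
  (f : GaloisMonoidPair.Iso D₁.tmPair π.D.tmPair)

/-- Pointwise heart of the naturality: on `ζ ∈ μ_Ẑ(M)`, THE junction of `k₁` read through `π ∘ f^gp` and re-targeted
along `μ_Ẑ(ᾱ)` agrees with THE junction of `k₂` read through `π`. [cite: MochizukiAbsTopIII2015, Remark 3.2.1 p.73] -/
theorem muZhat_congr_fund_cyclotomeCongr (ζ : cyclotome P.M) :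
    muZhat.congr f.absGaloisIso (C₁.cyclotomeUnitsEquivMuZhatFund (C₁.cyclotomeNonZeroDivisorsEquiv
        (MonoidKummerTheory.cyclotomeCongr (f.tlgIso.trans π.iso).isoM.symm ζ))) =
      π.C.cyclotomeUnitsEquivMuZhatFund (π.C.cyclotomeNonZeroDivisorsEquiv
        (MonoidKummerTheory.cyclotomeCongr π.iso.isoM.symm ζ)) := by
  have hξ : MonoidKummerTheory.cyclotomeCongr π.iso.isoM.symm ζ =
      MonoidKummerTheory.cyclotomeCongr f.tlgIso.isoM
        (MonoidKummerTheory.cyclotomeCongr (f.tlgIso.trans π.iso).isoM.symm ζ) := by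
    refine Subtype.ext (funext fun n => Units.ext ?_)
    change π.iso.isoM.symm (((ζ : ℕ+ → (P.M)ˣ) n : (P.M)ˣ) : P.M) =
      f.tlgIso.isoM (f.tlgIso.isoM.symm (π.iso.isoM.symm (((ζ : ℕ+ → (P.M)ˣ) n : (P.M)ˣ) : P.M)))
    rw [MulEquiv.apply_symm_apply]
  rw [hξ, GaloisMonoidPair.Iso.cyclotomeNonZeroDivisorsEquiv_cyclotomeCongr_tlgIso,
    GaloisMonoidPair.Iso.cyclotomeUnitsEquivMuZhatFund_map_unitsLift, ← muZhat.coe_congr]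

/-- **Naturality of Prop 3.3 (i) clause (c) (`TLG`, THE junction) across base fields**: the presentation `π ∘ f^gp` by
`(k₁, k̄₁)` — THE class re-targeted along the group-theoretic `μ_Ẑ(ᾱ) : μ_Ẑ(G_{k₁}) ⥲ μ_Ẑ(G_{k₂})` — and the presentation `π`
by `(k₂, k̄₂)` have the SAME class of identifications `μ_Ẑ(M) ⥲ μ_Ẑ(G_{k₂})`.  (Along `± f^gp` by the twist criterion;
along arbitrary `TLG`-isomorphisms = the uniqueness half of Prop. 3.3 (ii), not claimed.)
[cite: MochizukiAbsTopIII2015, Proposition 3.3 (i) p.73] -/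
theorem unitKummerTheoryMuZhatFund_cycIsoClass_of_tmIso :
    @Eq (Set (cyclotome P.M ≃* muZhat (absoluteGaloisGroup π.C.k)))
      (((TLGPresentation.mk C₁ D₁ (f.tlgIso.trans π.iso) : P.TLGPresentation).unitKummerTheoryMuZhatFund.mapCyclotome
          (muZhat.congr f.absGaloisIso)).cycIsoClass)
      π.unitKummerTheoryMuZhatFund.cycIsoClass := by
  -- the common member: `μ_Ẑ(M) ⥲ μ_Ẑ(k̄₂^×) ⥲ Λ(k̄₂ˣ) ⥲ μ_Ẑ(G_{k₂})` through `π`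
  have hB : ((MonoidKummerTheory.cyclotomeCongr π.iso.isoM.symm).trans π.C.cyclotomeNonZeroDivisorsEquiv).trans
        π.C.cyclotomeUnitsEquivMuZhatFund ∈ π.unitKummerTheoryMuZhatFund.cycIsoClass :=
    ⟨(MonoidKummerTheory.cyclotomeCongr π.iso.isoM.symm).trans π.C.cyclotomeNonZeroDivisorsEquiv,
      ⟨π.C.cyclotomeNonZeroDivisorsEquiv, Or.inl rfl, rfl⟩, rfl⟩
  have hA : ((MonoidKummerTheory.cyclotomeCongr π.iso.isoM.symm).trans π.C.cyclotomeNonZeroDivisorsEquiv).trans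
        π.C.cyclotomeUnitsEquivMuZhatFund ∈
      ((TLGPresentation.mk C₁ D₁ (f.tlgIso.trans π.iso) : P.TLGPresentation).unitKummerTheoryMuZhatFund.mapCyclotome
          (muZhat.congr f.absGaloisIso)).cycIsoClass :=
    ⟨((MonoidKummerTheory.cyclotomeCongr (f.tlgIso.trans π.iso).isoM.symm).trans C₁.cyclotomeNonZeroDivisorsEquiv).trans
        C₁.cyclotomeUnitsEquivMuZhatFund,
      ⟨(MonoidKummerTheory.cyclotomeCongr (f.tlgIso.trans π.iso).isoM.symm).trans C₁.cyclotomeNonZeroDivisorsEquiv,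
        ⟨C₁.cyclotomeNonZeroDivisorsEquiv, Or.inl rfl, rfl⟩, rfl⟩,
      MulEquiv.ext fun ζ => π.muZhat_congr_fund_cyclotomeCongr f ζ⟩
  -- two `TLG` classes (each the `{±1}`-orbit of any member) with a common member coincide
  refine Set.Subset.antisymm (fun e he => ?_) (fun e he => ?_)
  · obtain ⟨u, hu, hcomp⟩ := UnitKummerTheory.cycIsoClass_torsor _ _ hA e he
    obtain ⟨e', he', hcomp'⟩ := UnitKummerTheory.cycIsoClass_full _ _ hB u hu
    have heq : (e' : cyclotome P.M ≃* muZhat (absoluteGaloisGroup π.C.k)) = e :=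
      MulEquiv.ext fun ζ => (hcomp' ζ).trans (hcomp ζ).symm
    exact heq ▸ he'
  · obtain ⟨u, hu, hcomp⟩ := UnitKummerTheory.cycIsoClass_torsor _ _ hB e he
    obtain ⟨e', he', hcomp'⟩ := UnitKummerTheory.cycIsoClass_full _ _ hA u hu
    have heq : (e' : cyclotome P.M ≃* muZhat (absoluteGaloisGroup π.C.k)) = e :=
      MulEquiv.ext fun ζ => (hcomp' ζ).trans (hcomp ζ).symm
    exact heq ▸ he'

end TLGPresentation

namespace TCGPresentation

variable {P : GaloisMonoidPair.{0}} (π₁ π₂ : P.TCGPresentation)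

/-- **`TCG`: any two presentations (any base fields) and ANY identification `g : μ_Ẑ(G_{k₁}) ⥲ μ_Ẑ(G_{k₂})` of the targets
give the same class** — for `TCG` the class is every isomorphism onto the target (`Ẑ^×`-torsor): clause (c) carries no
datum for `TCG` (content-light by print). [cite: MochizukiAbsTopIII2015, Proposition 3.3 (i) p.73] -/
theorem unitKummerTheoryMuZhatFund_cycIsoClass_of_muZhat_congr
    (g : muZhat (absoluteGaloisGroup π₁.C.k) ≃* muZhat (absoluteGaloisGroup π₂.C.k)) :
    @Eq (Set (cyclotome P.M ≃* muZhat (absoluteGaloisGroup π₂.C.k)))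
      ((π₁.unitKummerTheoryMuZhatFund.mapCyclotome g).cycIsoClass) π₂.unitKummerTheoryMuZhatFund.cycIsoClass :=
  Set.Subset.antisymm (fun e _ => π₂.unitKummerTheoryMuZhatFund.mem_cycIsoClass_of_TCG e)
    (fun e _ => (π₁.unitKummerTheoryMuZhatFund.mapCyclotome g).mem_cycIsoClass_of_TCG e)

end TCGPresentation

end GaloisMonoidPair

end Literature.AnabelianGeometry.AbsoluteAnabelian

end
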